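import Summits.BirchSwinnertonDyer.BirchSwinnertonDyer.Theorems.PrintX10bBeyondCarrierOfTenPrintLeavesIntended
import Summits.BirchSwinnertonDyer.BirchSwinnertonDyer.Theorems.PrintX10bControlGlueKSAnyClassNumber
import HarnessLib

/-!
# Crux `BeyondCarrierDepthX10b` (stmt-BirchSwinnertonDyer-23055, PrintX10b aside r301), line «twins» — CENSUS over Howard Thm. 1.6.1
# AS INTENDED (F-161′): the crux BY NAME from TEN cite-only print facts with F-161′ in place of F-161 (part C3, closed forms)

HONEST FRAMING (cell `run/shared/lean/pub/bsd-print-x9/`, seat bsd-line-x10b-p1 LEAD g13, registered line «twins», skeleton v8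
`Cruxes/BeyondCarrierDepthX10b/Lines/twins.lean` sha d9aa95dab226; D-0154 KEY row 10): THEOREMS ONLY, conditional glue `--supports 23055`
(helper); nothing booked, nothing closed. «beyond-print theorem»: NO. BSD is not proved by any of this; no summit statement is proved by
this seat.

This is `PrintX10bBeyondCarrierOfTenPrintLeavesClosed` (p695500, the census of record, LEAD g11) VERBATIM with the leaf `h161 :
thm161_dvrKolyvaginBound` (F-161, Howard Thm. 1.6.1 as worded) replaced by `h161 : thm161_dvrKolyvaginBound_printIntended` (F-161′, Thm.
1.6.1 as intended by its printed proof, lit g45 p710086) — part C2's `_intended_of_controlGlue` forms specialised at x10b-p1-w8 g9's kernel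
theorem `HeegnerMuPartControlGlue.controlGlueKS_anyClassNumber`.  The point: the cell's engine reaches F-161′ (not F-161) BY NAME as
`thm161_printIntended_of_prop141 (h141 : prop141_casselsTate_skewPairing_atLevel) (hPT)` (x10b-p1-w2 lineage, «Thm161OfEngineBricks»);
composing it here (a later APPEND, when that theorem is in the tree) turns the census leaf «Howard Thm. 1.6.1» into the strictly smaller print
input «Howard Prop. 1.4.1 / Thm. 1.4.2 (Flach)» — still TEN cite-only leaves.
* `HowardFrames.upperLinkX10b_anyClassNumber_of_howardIntended_kolyvaginSystem_of_printFacts (hCGLS h57 h59gp h422 h513 h331 h161 h411)`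
  — U₃ on EVERY X10b frame, `h161 : F-161′`.
* **`HowardFrames.beyondCarrierDepthX10b_of_tenPrintLeaves_intended (hCGLS h57 h59gp h422 h513 h331 hChaL hKo h161 h411) :
  BeyondCarrierDepthX10b`**, `h161 : F-161′` — the census over print-as-intended.
What is NOT proved: any of the ten leaves; the crux unconditionally; BSD.

References: [CastellaGrossiLeeSkinner2022] Thm. 4.1.1, Rem. 4.1.4, Thm. 4.1.3, Cor. 3.4.2, Thm. 5.1.3; [Howard2004HeegnerKolyvagin] Thm. 1.6.1
(print-as-intended scope p0004 L47–52, p0006 L84–92), Thm. 2.2.10 (proof), §3.3; [YanZhu2024MainConjNonCM] Thm. 5.7 (1), 5.9;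
[BurungaleCastellaSkinner2025] Prop. 4.2.2; [JetchevSkinnerWan2017] Thm. 3.3.1; [Cha2005] Rmk. 25; [Kolyvagin1990] Thm. A; [Castella2018] §5;
[LombardoTronto2022] Prop. 3.12; [PerrinRiou1987BSMF] §3; [Cox2013] Thm. 7.24 / 11.1.
-/

-- the REGISTERED stub namespace `Summit.BirchSwinnertonDyer.BirchSwinnertonDyer.Cruxes.…` repeats the summit name
set_option linter.dupNamespace false
set_option autoImplicit false

noncomputable section

open scoped Classical Pointwise ContRepresentation TensorProduct NumberField

open WeierstrassCurve NumberField IsDedekindDomain Field Literature Literature.NumberTheory.EllipticCurves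
  Literature.NumberTheory.EllipticCurves.ModularForms Literature.NumberTheory.EllipticCurves.Rank1Residual
  Literature.NumberTheory.EllipticCurves.Castella2018 Literature.NumberTheory.EllipticCurves.YanZhu2026
  Literature.NumberTheory.EllipticCurves.CastellaGrossiLeeSkinner2022
  Literature.NumberTheory.EllipticCurves.JetchevSkinnerWan2017
open Literature.NumberTheory.GaloisCohomology Literature.NumberTheory.GaloisCohomology.Howard2004
open Literature.NumberTheory.GaloisRepresentations Literature.NumberTheory.GaloisRepresentations.DiscreteGaloisModule

open Summit.BirchSwinnertonDyer.Rank1Residual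
open Summit.BirchSwinnertonDyer.BirchSwinnertonDyer.Theorems
open Summit.BirchSwinnertonDyer.BirchSwinnertonDyer.Theorems.HeegnerMuPartControlGlue (Stmt.kummerStrictOnFrames)
open Summit.BirchSwinnertonDyer.BirchSwinnertonDyer.Theses.PrintX10b (BeyondCarrierDepthX10b)

namespace Summit.BirchSwinnertonDyer.BirchSwinnertonDyer.Cruxes.BeyondCarrierDepthX10b.HowardFrames

/-- **U₃ on EVERY X10b frame — any class number — from Howard Thm. 1.6.1 AS INTENDED (`h161` : F-161′) and CGLS Thm. 4.1.1 (`h411`) modulo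
six further print facts** (`hCGLS h57 h59gp h422 h513 h331`): part C2's `_of_controlGlue` form at the kernel theorem
`HeegnerMuPartControlGlue.controlGlueKS_anyClassNumber`.
[cite: Howard2004HeegnerKolyvagin, Thm. 1.6.1, Thm. 2.2.10 (proof) and §3.3] [cite: CastellaGrossiLeeSkinner2022, Thm. 4.1.1, Thm. 4.1.3 and Cor. 3.4.2]
[cite: YanZhu2024MainConjNonCM, Thm. 5.7 (1) and Thm. 5.9] [cite: BurungaleCastellaSkinner2025, Prop. 4.2.2] [cite: JetchevSkinnerWan2017, Thm. 3.3.1]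
[cite: Castella2018, §5 (eq:IMC+BDP)] [cite: PerrinRiou1987BSMF, §3.2] -/
theorem upperLinkX10b_anyClassNumber_of_howardIntended_kolyvaginSystem_of_printFacts
    (hCGLS : thm413_rankOne_charIdeal_torsion_dvd_localized.{0})
    (h57 : thm57_isTorsion_charIdealXGr_eq_bdpLFunction)
    (h59gp : ∀ {p : ℕ} [Fact p.Prime] (ι' : PadicAlgCl p ≃+* ℂ) (W : WeierstrassCurve ℚ) [W.IsElliptic]
      [W.IsGloballyMinimal] (K : Type) [Field K] [NumberField K] (v vbar : HeightOneSpectrum (𝓞 K))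
      (κ : ZpExtension K p) (γ : absoluteGaloisGroup K) [Fact (κ.IsTopGenerator γ)] {N : ℕ} [NeZero N]
      {f : CuspForm (CongruenceSubgroup.Gamma0 N) 2} (jbar : AlgebraicClosure K →+* ℂ)
      (_ : IsNewformOf W f),
      N = W.conductorNorm ℤ → 3 ≤ p → GoodOrd W p → (W.baseChange K).HasIrreducibleModPGaloisRep p →
      IsImaginaryQuadratic K → SatisfiesHeegnerHypothesis N K →
        ((Ideal.span {(p : ℤ)}).primesOver (𝓞 K)).ncard = 2 →
        Odd (NumberField.discr K) → NumberField.discr K ≠ -3 → κ.IsAnticyclotomic →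
      (∀ (w : InfinitePlace K) (k : 𝓞 K), k ∈ v.asIdeal ↔ ‖ι'.symm (w.embedding (k : K))‖ < 1) →
        ((p : ℕ) : 𝓞 K) ∈ vbar.asIdeal → vbar ≠ v →
      ∃ (ΩK : ℂ) (Ωp : (unrIntegers p)ˣ) (L : UnrSeries p),
        ΩK ≠ 0 ∧ IsBDPLFunction ι' v κ γ f ΩK ((Ωp : unrIntegers p) : ℂ_[p]) L ∧
        ∀ (D : (W.baseChange K).LambdaAdicSelmerData κ γ) (F : HeegnerFamily N W K κ jbar)
          (X : (W.baseChange K).SelmerDualData κ γ) (j : ℤ_[p] →+* unrIntegers p),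
          ¬ (p : ℤ) ∣ F.Dt.c →
          (∀ x : ℤ_[p], ((j x : unrIntegers p) : ℂ_[p]) = algebraMap ℚ_[p] ℂ_[p] (x : ℚ_[p])) →
          heegnerCharIdeal D F ^ 2 ≤
              Module.charIdeal (IwasawaAlgebra p) (Submodule.torsion (IwasawaAlgebra p) X.X) →
            L ∈ (AcSelmer.XAc.charIdeal (W.baseChange K) p κ vbar ∅ γ).map (PowerSeries.map j))
    (h422 : BurungaleCastellaSkinner2025.prop422_exists_isBDPLFunction_mu_eq_zero)
    (h513 : thm513_exists_isBDPLFunction_valueAtOne_disc)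
    (h331 : thm331_anticyclotomicControl)
    (h161 : Literature.NumberTheory.GaloisCohomology.Howard2004.thm161_dvrKolyvaginBound_printIntended)
    (h411 : CastellaGrossiLeeSkinner2022.thm411_exists_kolyvaginSystem_one_ne_zero) :
    ∀ (W : WeierstrassCurve ℚ) [W.IsElliptic] [W.IsGloballyMinimal] (p : ℕ) [Fact p.Prime]
    [NeZero (W.conductorNorm ℤ)] (K : Type) [Field K] [NumberField K],
    Literature.NumberTheory.EllipticCurves.Rank1Residual.ClassX10 W p →
    ¬ Literature.NumberTheory.EllipticCurves.Rank1Residual.Surj W 3 → ¬ W.HasCM →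
    Literature.NumberTheory.EllipticCurves.IsImaginaryQuadratic K → Odd (NumberField.discr K) →
    NumberField.discr K ≠ -3 →
    Literature.NumberTheory.EllipticCurves.SatisfiesHeegnerHypothesis (W.conductorNorm ℤ) K →
    Literature.NumberTheory.EllipticCurves.SatisfiesHeegnerHypothesis p K →
    (W.baseChange K).HasIrreducibleModPGaloisRep p →
    ∀ (ι : K →+* ℚ_[p]) (κ : Literature.NumberTheory.EllipticCurves.ZpExtension K p), κ.IsAnticyclotomic →
    ∀ (γ : Field.absoluteGaloisGroup K) [Fact (κ.IsTopGenerator γ)]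
    (Dt : Literature.NumberTheory.EllipticCurves.ModularForms.ModularParametrizationData W
    (W.conductorNorm ℤ)), ¬ (p : ℤ) ∣ Dt.c →
    ∀ (H : Literature.NumberTheory.EllipticCurves.HeegnerDatum (W.conductorNorm ℤ) (NumberField.discr K))
    (ιC : K →+* ℂ) (P : (W.baseChange K).toAffine.Point),
    WeierstrassCurve.Affine.Point.map ιC.toRatAlgHom P =
    Literature.NumberTheory.EllipticCurves.ModularForms.heegnerPointComplex Dt H →
    (W.baseChange K).mordellWeilRank = 1 →
    Finite (AddCommGroup.primaryComponent (W.baseChange K).sha p) → ¬ IsOfFinAddOrder P →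
    ∃ n : ℕ, Summit.BirchSwinnertonDyer.Rank1Residual.X11b.AcSelmer.XAc.HasCharValuationAt
    (W.baseChange K) p κ (Summit.BirchSwinnertonDyer.Rank1Residual.X11b.inducedPlace ι) ∅ γ n ∧
    (n : ℤ) ≤ 2 * (Summit.BirchSwinnertonDyer.Rank1Residual.X11b.padicLogOrd W p ι P +
    (padicValInt p (1 - W.frobeniusTrace p + p) : ℤ) - 1) :=
  upperLinkX10b_anyClassNumber_of_howardIntended_kolyvaginSystem_of_printFacts_of_controlGlue hCGLS h57 h59gp h422 h513 h331
    h161 h411 HeegnerMuPartControlGlue.controlGlueKS_anyClassNumber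

/-- **CENSUS over print-as-intended — crux `BeyondCarrierDepthX10b` (stmt-BirchSwinnertonDyer-23055) BY NAME from TEN cite-only print facts,
nothing else, with Howard Thm. 1.6.1 AS INTENDED (F-161′) for F-161**: `hCGLS` CGLS Thm. 4.1.3 · `h57` `h59gp` `h422` `h513` `h331` (pinned transfer, JSW control) · `hChaL` Cha Rmk. 25 · `hKo` Kolyvagin
Thm. A · `h161` Howard Thm. 1.6.1 as intended (F-161′) · `h411` CGLS Thm. 4.1.1 (KS form). No case split on `3 ∣ h_K`, no Mastella–Zerman 2026, no Carayol, no
Greenberg Prop. 2.4, no CGLS 4.1.1 torsion typing (census history 14 → 12 → 11 → 10, see the module docstring). What is NOT proved: any of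
the ten leaves; the crux unconditionally; BSD. CONDITIONAL; credits nothing.
[cite: CastellaGrossiLeeSkinner2022, Thm. 4.1.1, Thm. 4.1.3 and Thm. 5.1.3] [cite: Howard2004HeegnerKolyvagin, Thm. 1.6.1 and Thm. 2.2.10 (proof)]
[cite: YanZhu2024MainConjNonCM, Thm. 5.7 (1), 5.9] [cite: BurungaleCastellaSkinner2025, Prop. 4.2.2] [cite: JetchevSkinnerWan2017, Thm. 3.3.1]
[cite: Cha2005, Rmk. 25] [cite: Kolyvagin1990, Thm. A] [cite: Cox2013, §7.D Thm. 7.24 and §11.A Thm. 11.1] [cite: PerrinRiou1987BSMF, §3.2] -/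
theorem beyondCarrierDepthX10b_of_tenPrintLeaves_intended
    (hCGLS : thm413_rankOne_charIdeal_torsion_dvd_localized.{0})
    (h57 : thm57_isTorsion_charIdealXGr_eq_bdpLFunction)
    (h59gp : ∀ {p : ℕ} [Fact p.Prime] (ι' : PadicAlgCl p ≃+* ℂ) (W : WeierstrassCurve ℚ) [W.IsElliptic]
      [W.IsGloballyMinimal] (K : Type) [Field K] [NumberField K] (v vbar : HeightOneSpectrum (𝓞 K))
      (κ : ZpExtension K p) (γ : absoluteGaloisGroup K) [Fact (κ.IsTopGenerator γ)] {N : ℕ} [NeZero N]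
      {f : CuspForm (CongruenceSubgroup.Gamma0 N) 2} (jbar : AlgebraicClosure K →+* ℂ)
      (_ : IsNewformOf W f),
      N = W.conductorNorm ℤ → 3 ≤ p → GoodOrd W p → (W.baseChange K).HasIrreducibleModPGaloisRep p →
      IsImaginaryQuadratic K → SatisfiesHeegnerHypothesis N K →
        ((Ideal.span {(p : ℤ)}).primesOver (𝓞 K)).ncard = 2 →
        Odd (NumberField.discr K) → NumberField.discr K ≠ -3 → κ.IsAnticyclotomic →
      (∀ (w : InfinitePlace K) (k : 𝓞 K), k ∈ v.asIdeal ↔ ‖ι'.symm (w.embedding (k : K))‖ < 1) →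
        ((p : ℕ) : 𝓞 K) ∈ vbar.asIdeal → vbar ≠ v →
      ∃ (ΩK : ℂ) (Ωp : (unrIntegers p)ˣ) (L : UnrSeries p),
        ΩK ≠ 0 ∧ IsBDPLFunction ι' v κ γ f ΩK ((Ωp : unrIntegers p) : ℂ_[p]) L ∧
        ∀ (D : (W.baseChange K).LambdaAdicSelmerData κ γ) (F : HeegnerFamily N W K κ jbar)
          (X : (W.baseChange K).SelmerDualData κ γ) (j : ℤ_[p] →+* unrIntegers p),
          ¬ (p : ℤ) ∣ F.Dt.c →
          (∀ x : ℤ_[p], ((j x : unrIntegers p) : ℂ_[p]) = algebraMap ℚ_[p] ℂ_[p] (x : ℚ_[p])) →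
          heegnerCharIdeal D F ^ 2 ≤
              Module.charIdeal (IwasawaAlgebra p) (Submodule.torsion (IwasawaAlgebra p) X.X) →
            L ∈ (AcSelmer.XAc.charIdeal (W.baseChange K) p κ vbar ∅ γ).map (PowerSeries.map j))
    (h422 : BurungaleCastellaSkinner2025.prop422_exists_isBDPLFunction_mu_eq_zero)
    (h513 : thm513_exists_isBDPLFunction_valueAtOne_disc)
    (h331 : thm331_anticyclotomicControl)
    (hChaL : Cha2005.rmk25_pow_dvd_card_sha_primary_of_certificate)
    (hKo : ∀ (N : ℕ) [NeZero N] (W : WeierstrassCurve ℚ) (K : Type) [Field K] [NumberField K],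
      kolyvagin N W K)
    (h161 : Literature.NumberTheory.GaloisCohomology.Howard2004.thm161_dvrKolyvaginBound_printIntended)
    (h411 : CastellaGrossiLeeSkinner2022.thm411_exists_kolyvaginSystem_one_ne_zero) :
    BeyondCarrierDepthX10b :=
  beyondCarrierDepthX10b_of_tenPrintLeaves_intended_of_controlGlue hCGLS h57 h59gp h422 h513 h331 hChaL hKo h161 h411
    HeegnerMuPartControlGlue.controlGlueKS_anyClassNumber

end Summit.BirchSwinnertonDyer.BirchSwinnertonDyer.Cruxes.BeyondCarrierDepthX10b.HowardFrames

end
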